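import Summits.HodgeConjecture.HodgeConjecture.Cruxes.BlochSeedDiscOne.BoxCap
import Summits.HodgeConjecture.HodgeConjecture.Cruxes.BlochSeedDiscOne.ShellThreeFloorB
import Summits.HodgeConjecture.HodgeConjecture.Cruxes.BlochSeedDiscOne.DeepLayerLaws
import Summits.HodgeConjecture.HodgeConjecture.Cruxes.BlochSeedDiscOne.SigmaH
import Summits.HodgeConjecture.HodgeConjecture.Cruxes.BlochSeedDiscOne.RingTwoEffEmpty

/-!
# ShellThreeClosed — the SHELL-3 KERNEL PLATE `shell3_empty_of_binders` (commission R19.713 (K) ∕ plan R19.724 (2) ∕ summon R19.726)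

`line stmt-HodgeConjecture-18881 Cruxes/BlochSeedDiscOne/Lines/birth.lean 814a6a70c14e831a stub_rung_pad4_seedAt`
(plan-lens-HodgeAV-dual g17, 2026-08-31; (P0) + (P4) + ASSEMBLY of the plate whose (P1) is `ShellThreeFloorB` v2 @9905718a6bee (dual g16)
and whose (P2)(P3) are `BoxCap` v2 @e96120440c82 (plan-lens-HodgeAV-negation g22); the budget∕shell plumbing of `ShellLedger` v1.0 (strengthen
g17∕g18: `copies + rank ≤ 116`, shells 1∕2 closed, the shift dictionary) is RESTATED here over its built sources (`RingTwoEffEmpty`,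
`RingTwoMassLaw.ClassLaw.sPlus_ring2`, `DeepLayerLaws.ringRoomB_iff_sPlusB`, `RuleDPlate.budgetClause_shiftD`, `SigmaH.sigmaH_shiftD`) so that this
module does not wait on the `ShellLedger` build; imports: `BoxCap`, `ShellThreeFloorB`, `DeepLayerLaws`, `SigmaH`, `RingTwoEffEmpty`).
KERNEL STATEMENTS ONLY — no `sorry`, no new axiom, no `instance`, no `notation`, no `decide`, no `native_decide`.
**Nothing here is proved toward HC ∕ HC_CM ∕ HC_AV ∕ №4 ∕ 26512 ∕ 18881 ∕ H2.**  Letters ≠ sheaves ≠ SEED.  A closed shell of the letter-model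
statement of record `SPlus 14 σ_H 0` is READING-1 bookkeeping and registers nothing on 18881 ∕ H2; `Nonex 14 199 8` stays REFUTED as typed.

## THE THREE DISPLAYED BINDERS (support-level machine facts of OTHER seats; hypotheses here, NOT proved here)
* (B)  `ShellThreeFloorB.HubfreePB D`     — every hub-free supported P cell has co-levels `≤ 2`, and next to an off-axis letter only units
                                            (gs-eng-2 RESULT-4 (B) ∕ check-static BATCH 198; ×-ledger R19.718);
* (Bu) `ShellThreeFloorB.NoOffHubfreeP D` — no hub-free supported P cell has an off-axis letter («P Buuu = ∅» on top of (B));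
* (M2) `BoxCap.NHubbed h D`               — every supported N cell carries the hub letter `(h; 0, 0)` (equivalently, on the alphabet,
                                            `NoHubfreeN D`: some letter of co-level `0` — `nHubbed_iff_noHubfreeN`; NU4 pen ×2 + capped DFS ×3).
«hub-free» is ONE notion on the alphabet: `∀ f, c f ≠ hub h` ⟺ `∀ f, (c f).colevel ≠ 0` (`eq_hub_of_col_zero`), so negation's binder
`BoxCap.HubfreePAxis h D` is a COROLLARY of (Bu) (`hubfreePAxis_of_noOff`) and is not displayed separately.

## THE THEOREMS
* `pmass_ge_51_of_binders` — **THE SHELL-3 P-MASS FLOOR** (budget-free, Hall-free): on the height-`h` alphabet, a design with (A1), RULE D, `Disj`,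
  ring `≤ 3`, `μ ≠ 0` and the three binders has `51 ≤ Σ_P m`.
* `shell3_empty_of_binders` — with the budget clause of ANY `σ ≥ 28·copies` (in particular `σ_H`, `SigmaH.diag_le_sigmaH`) and PortHall₈
  (`HallPlusUp D 8`): `Σ_P m ≤ 50` (`pmass_le_fifty`, (P0)) — contradiction.  Stated (i) with the binders as three hypotheses on `D`
  (`shell3_empty_of_binders`, `shell3_empty_of_binders_col` with (M2) in co-level currency), (ii) in the exact binder order of
  `DeepLayerLaws.RingRoomB h (BudgetClause σ 0) 3` (`shell3_empty_roomShape`), and (iii) as the CONDITIONAL CLOSURES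
  `ringRoom_three_closed_of_binders : (binders on every design of room 3) → RingRoomB h (BudgetClause σ 0) 3`,
  `sPlus_three_sigmaH_of_binders : … → SPlus 3 σ_H 0` (via the shift dictionary `ringRoom_iff_sPlus` at height 14, or shift-free at height 3:
  `sPlus_three_of_binders_height_three`), and the residual ledger `sPlus_fourteen_sigmaH_iff_shells_from_four_of_binders :
  … → (SPlus 14 σ_H 0 ↔ shells 4 … 14)` (shells 1, 2 kernel-closed unconditionally: `shell_one_closed`, `shell_two_closed_sigma`).

## THE CHAIN (S := Σ_P m·ρ_h, ρ_h(c) = ∏_f (h − a_f) = dep_h(c); HF := Σ_P m·[ρ_h > 0] = the hub-free P mass; M := Σ_P m)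
* (P1) dual floor `ShellThreeFloorB.nine_negE_add_hubfreeMass_le` [(B),(Bu)]:        `9·(−E_h) + Σ_P m·(8 − hubEight) ≤ 8·M`;
* dictionary (this file, §1): `E_h = Σ_h` (`E_eq_Sigma`, `rfl`: `RingTwoMassLaw.dep = BoxIdentity.rho`), `Σ_h = −S` under (M2)
  (`BoxCap.sigma_eq_neg_pmass`), and `Σ_P m·(8 − hubEight) = 8·HF` (`hubfreeMass_eq`);                so   `9·S + 8·HF ≤ 8·M`;
* (P2)(P3) negation `BoxCap.pmass_ge_24` [(M2),(Bu)]: `S ≥ 24`;  `BoxCap.sixteen_pmass_le` (BOXCAP): `16·S ≤ (S − 8)·HF`;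
* (P4) `arith_close`: for reals `S ≥ 24`, `HF`, `M` with the three displayed inequalities, `8·M·(S − 8) ≥ 9·S·(S − 8) + 128·S ≥ 408·(S − 8)`
  (the last step is `(S − 24)(9S − 136) ≥ 0`), so `M ≥ 51`; digits at `S = 8q`: `q = 3`: `27 + 24 = 51`; `q = 4`: `36 + 22`; `q = 5`: `45 + 20`;
  `q ≥ 6`: `9q ≥ 54` — no `8 ∣ S` is needed, the real inequality already clears `50`.
* (P0) `pmass_le_fifty`: `BudgetClause σ 0 D ∧ σ D ≥ 28·copies ⟹ copies + rank ≤ 116` (`omega`; = `ShellLedger.copies_add_rank_le_116_of_budget`), i.e.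
  `Σ_N m ≤ 58`; PortHall₈ gives `rank ≥ 8` on a non-empty P side (`RuleDPlate.eight_le_rank_of_hallPlusUp`), so `Σ_P m ≤ 50` (trivially so if
  the P side is empty).
What is NOT here: the discharge of (B), (Bu), (M2) (support-enumeration certificates, other seats: the ×3–×4 mechanical ledger of R19.718), the
second road (S3)∕nine-eighths (negation ∕ anomaly PLATES #29∕#30∕#32), and anything about shells `≥ 4`.
-/

set_option linter.dupNamespace false
set_option autoImplicit false

namespace Summit.HodgeConjecture.HodgeConjecture.Cruxes.BlochSeedDiscOne.ShellThreeClosed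

open Summit.HodgeConjecture.HodgeConjecture.Cruxes.BlochSeedDiscOne.DepthBoundA4
open Summit.HodgeConjecture.HodgeConjecture.Cruxes.BlochSeedDiscOne.LeggedFloor (RuleD Disj mem_supp_of_memP mem_supp_of_memN)
open Summit.HodgeConjecture.HodgeConjecture.Cruxes.BlochSeedDiscOne.HallB136 (HallUp)
open Summit.HodgeConjecture.HodgeConjecture.Cruxes.BlochSeedDiscOne.RuleDPlate
  (HallPlusUp BudgetClause SPlus SPlusB eight_le_rank_of_hallPlusUp budgetClause_shiftD)
open Summit.HodgeConjecture.HodgeConjecture.Cruxes.BlochSeedDiscOne.DeepLayerLaws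
  (RingLe TouchesP RingRoomB RingShellB ringShellB_of_ringRoomB ringRoomB_iff_sPlusB sPlusB_of_shells shells_of_sPlusB)
open Summit.HodgeConjecture.HodgeConjecture.Cruxes.BlochSeedDiscOne.SigmaH (sigmaH diag_le_sigmaH sigmaH_shiftD)
open Summit.HodgeConjecture.HodgeConjecture.Cruxes.BlochSeedDiscOne.RingFourEmpty (linZ_smul linZ_mono)
open Summit.HodgeConjecture.HodgeConjecture.Cruxes.BlochSeedDiscOne.RingTwoMassLaw (linZ_congr')
open Summit.HodgeConjecture.HodgeConjecture.Cruxes.BlochSeedDiscOne.RingTwoMassLaw.ClassLaw (E dep)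
open Summit.HodgeConjecture.HodgeConjecture.Cruxes.BlochSeedDiscOne.ShellThreeFloorB
  (HubfreePB NoOffHubfreeP Ring3 OffAxis hubEight xy_zero_of_col_zero nine_negE_add_hubfreeMass_le)
open Summit.HodgeConjecture.HodgeConjecture.Cruxes.BlochSeedDiscOne.BoxIdentity (rho Sigma A1e a1e_of_a1)
open Summit.HodgeConjecture.HodgeConjecture.Cruxes.BlochSeedDiscOne.BoxCap
  (NHubbed AxisCell HubfreePAxis hfInd sigma_eq_neg_pmass pmass_ge_24 sixteen_pmass_le rho_pos_iff_nohub)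
open Summit.HodgeConjecture.HodgeConjecture.Cruxes.BlochSeedDiscOne.HeightTower (shiftD)
open Summit.HodgeConjecture.HodgeConjecture.Cruxes.BlochSeedDiscOne.RingTwoEffEmpty (ring1_mu_eq_zero_allHeights)
open Summit.HodgeConjecture.HodgeConjecture.Cruxes.BlochSeedDiscOne.RingTwoMassLaw.ClassLaw (sPlus_ring2)

/-! ## §1 The dictionary between the two kernel currencies (`RingTwoMassLaw`∕`ShellThreeFloorB`: co-levels, `dep`, `E`;
`BoxIdentity`∕`BoxCap`: hub letters, `ρ`, `Σ`) -/

/-- the co-level of the hub is `0`. -/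
theorem col_hub (h : ℤ) : (Letter.hub h).colevel = 0 := by
  simp [Letter.hub, Letter.colevel]

/-- on the height-`h` alphabet a letter of co-level `0` IS the hub `(h; 0, 0)`. -/
theorem eq_hub_of_col_zero {h : ℤ} {ℓ : Letter} (hℓ : ℓ.OnAlphabet h) (h0 : ℓ.colevel = 0) : ℓ = Letter.hub h := by
  obtain ⟨a, x, y⟩ := ℓ
  obtain ⟨hx, hy⟩ := xy_zero_of_col_zero h0
  obtain ⟨hh, -⟩ := hℓ
  simp only [Letter.height] at hh
  simp only at hx hy
  subst hx
  subst hy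
  simp only [abs_zero, add_zero] at hh
  subst hh
  rfl

/-- on the alphabet: co-level `0` ⟺ the hub. -/
theorem col_zero_iff_eq_hub {h : ℤ} {ℓ : Letter} (hℓ : ℓ.OnAlphabet h) : ℓ.colevel = 0 ↔ ℓ = Letter.hub h :=
  ⟨eq_hub_of_col_zero hℓ, fun he => by rw [he]; exact col_hub h⟩

/-- hub-free in the letter currency (`BoxCap`) ⟹ hub-free in the co-level currency (`ShellThreeFloorB`). -/
theorem col_ne_zero_of_ne_hub {h : ℤ} {c : Cell} (hc : ∀ f : Fin 4, (c f).OnAlphabet h)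
    (hne : ∀ f : Fin 4, c f ≠ Letter.hub h) (f : Fin 4) : (c f).colevel ≠ 0 :=
  fun h0 => hne f (eq_hub_of_col_zero (hc f) h0)

/-- … and conversely (no alphabet needed). -/
theorem ne_hub_of_col_ne_zero (h : ℤ) {c : Cell} (hne : ∀ f : Fin 4, (c f).colevel ≠ 0) (f : Fin 4) :
    c f ≠ Letter.hub h :=
  fun he => hne f (by rw [he]; exact col_hub h)

/-- `RingTwoMassLaw.dep` and `BoxIdentity.rho` are the same functional `∏_f (h − a_f)`. -/
theorem dep_eq_rho (h : ℤ) : dep h = rho h := rfl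

/-- hence `E_h = Σ_h` (`RingTwoMassLaw.E` = `BoxIdentity.Sigma`). -/
theorem E_eq_Sigma (h : ℤ) (D : Design) : E h D = Sigma h D := rfl

/-- under (M2): `−E_h = S := Σ_P m·ρ_h` (the N side is `ρ`-dead). -/
theorem negE_eq_pmass (h : ℤ) (D : Design) (hM2 : NHubbed h D) : - E h D = linZ D.P (rho h) := by
  rw [E_eq_Sigma, sigma_eq_neg_pmass h D hM2, neg_neg]

/-- (M2) in the co-level currency: every supported N cell has a letter of co-level `0`. -/
def NoHubfreeN (D : Design) : Prop := ∀ y ∈ D.suppN, ∃ f : Fin 4, (y f).colevel = 0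

theorem nHubbed_of_noHubfreeN {h : ℤ} {D : Design} (hD : D.OnAlphabet h) (hM : NoHubfreeN D) : NHubbed h D := by
  intro c hc
  obtain ⟨f, hf⟩ := hM c hc
  exact ⟨f, eq_hub_of_col_zero (hD c (mem_supp_of_memN D hc) f) hf⟩

theorem noHubfreeN_of_nHubbed {h : ℤ} {D : Design} (hM : NHubbed h D) : NoHubfreeN D := by
  intro c hc
  obtain ⟨f, hf⟩ := hM c hc
  exact ⟨f, by rw [hf]; exact col_hub h⟩

/-- on the alphabet the two currencies of (M2) agree. -/
theorem nHubbed_iff_noHubfreeN {h : ℤ} {D : Design} (hD : D.OnAlphabet h) : NHubbed h D ↔ NoHubfreeN D :=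
  ⟨noHubfreeN_of_nHubbed, nHubbed_of_noHubfreeN hD⟩

/-- negation's displayed binder `HubfreePAxis` («hub-free supported P cells are axis cells») is a corollary of (Bu). -/
theorem hubfreePAxis_of_noOff {h : ℤ} {D : Design} (hD : D.OnAlphabet h) (hNO : NoOffHubfreeP D) : HubfreePAxis h D := by
  intro c hc hne f
  have hcA : ∀ g : Fin 4, (c g).OnAlphabet h := hD c (mem_supp_of_memP D hc)
  have hcol : ∀ g : Fin 4, (c g).colevel ≠ 0 := col_ne_zero_of_ne_hub hcA hne
  have hno : ¬ OffAxis (c f) := hNO c hc hcol f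
  by_contra hax
  obtain ⟨hx, hy⟩ := not_or.mp hax
  exact hno ⟨hx, hy⟩

theorem fin4_cases (f : Fin 4) : f = 0 ∨ f = 1 ∨ f = 2 ∨ f = 3 := by
  fin_cases f <;> simp

/-- the hub-free indicators agree on the alphabet: `8 − hubEight c = 8·[ρ_h(c) > 0]`. -/
theorem eight_sub_hubEight_eq {h : ℤ} {c : Cell} (hc : ∀ f : Fin 4, (c f).OnAlphabet h) :
    8 - hubEight c = 8 * hfInd h c := by
  by_cases hρ : 0 < rho h c
  · have hne := (rho_pos_iff_nohub h c hc).1 hρ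
    have hcol : ∀ f : Fin 4, (c f).colevel ≠ 0 := col_ne_zero_of_ne_hub hc hne
    have H : ¬ ((c 0).colevel = 0 ∨ (c 1).colevel = 0 ∨ (c 2).colevel = 0 ∨ (c 3).colevel = 0) := by
      rintro (h0 | h0 | h0 | h0)
      exacts [hcol 0 h0, hcol 1 h0, hcol 2 h0, hcol 3 h0]
    unfold hubEight hfInd
    rw [if_neg H, if_pos hρ]
    norm_num
  · have hex : ∃ f : Fin 4, c f = Letter.hub h := by
      by_contra hno
      exact hρ ((rho_pos_iff_nohub h c hc).2 fun f hf => hno ⟨f, hf⟩)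
    obtain ⟨f, hf⟩ := hex
    have h0 : (c f).colevel = 0 := by rw [hf]; exact col_hub h
    have H : (c 0).colevel = 0 ∨ (c 1).colevel = 0 ∨ (c 2).colevel = 0 ∨ (c 3).colevel = 0 := by
      rcases fin4_cases f with rfl | rfl | rfl | rfl
      exacts [Or.inl h0, Or.inr (Or.inl h0), Or.inr (Or.inr (Or.inl h0)), Or.inr (Or.inr (Or.inr h0))]
    unfold hubEight hfInd
    rw [if_pos H, if_neg hρ]
    norm_num

/-- the hub-free P mass in the two currencies: `Σ_P m·(8 − hubEight) = 8·Σ_P m·[ρ_h > 0]`. -/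
theorem hubfreeMass_eq {h : ℤ} {D : Design} (hD : D.OnAlphabet h) :
    linZ D.P (fun c => 8 - hubEight c) = 8 * linZ D.P (hfInd h) := by
  rw [← linZ_smul]
  exact linZ_congr' D.P _ _ fun cm hcm hpos =>
    eight_sub_hubEight_eq (hD cm.1 (mem_supp_of_memP D ((mem_suppP_iff D cm.1).2 ⟨cm.2, by simpa using hcm, hpos⟩)))

/-! ## §2 (P4) The arithmetic close -/

/-- **(P4)** no reals `S ≥ 24`, `HF`, `M ≤ 50` satisfy `9S + 8·HF ≤ 8M` and `16S ≤ (S − 8)·HF`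
(`8M(S − 8) ≥ 9S(S − 8) + 128S = 9S² + 56S ≥ 408(S − 8)` since `(S − 24)(9S − 136) ≥ 0`). -/
theorem arith_close {S HF M : ℤ} (h24 : 24 ≤ S) (h9 : 9 * S + 8 * HF ≤ 8 * M) (hM : M ≤ 50)
    (h16 : 16 * S ≤ (S - 8) * HF) : False := by
  have hA : (S - 8) * (8 * HF) ≤ (S - 8) * (400 - 9 * S) :=
    mul_le_mul_of_nonneg_left (by linarith) (by linarith)
  nlinarith [mul_nonneg (show (0 : ℤ) ≤ S - 24 by linarith) (show (0 : ℤ) ≤ 9 * S - 128 by linarith)]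

/-- the same as a floor: `9S + 8·HF ≤ 8M`, `16S ≤ (S − 8)·HF`, `S ≥ 24` force `M ≥ 51`. -/
theorem fiftyone_le {S HF M : ℤ} (h24 : 24 ≤ S) (h9 : 9 * S + 8 * HF ≤ 8 * M) (h16 : 16 * S ≤ (S - 8) * HF) :
    51 ≤ M := by
  by_contra hlt
  exact arith_close h24 h9 (by omega) h16

/-! ## §3 (P0) The P-budget `Σ_P m ≤ 50` under the budget clause and PortHall₈ -/

/-- **(P0)** under the budget clause of any `σ ≥ 28·copies` (so `copies + rank ≤ 116`, i.e. `Σ_N m ≤ 58`) and PortHall₈ (`rank ≥ 8` on a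
non-empty P side): `Σ_P m ≤ 50`. -/
theorem pmass_le_fifty (σ : Design → ℤ) {D : Design} (hσ : 28 * (D.copies : ℤ) ≤ σ D) (hb : BudgetClause σ 0 D)
    (hp : HallPlusUp D 8) : (((D.P.map Prod.snd).sum : ℕ) : ℤ) ≤ 50 := by
  have h116 : (D.copies : ℤ) + D.rank ≤ 116 := by
    unfold BudgetClause at hb
    omega
  have hc : (D.copies : ℤ) = (((D.N.map Prod.snd).sum : ℕ) : ℤ) + (((D.P.map Prod.snd).sum : ℕ) : ℤ) := by
    simp only [Design.copies, Nat.cast_add]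
  have hr : D.rank = (((D.N.map Prod.snd).sum : ℕ) : ℤ) - (((D.P.map Prod.snd).sum : ℕ) : ℤ) := rfl
  by_cases hpos : 0 < (D.P.map Prod.snd).sum
  · have h8 := eight_le_rank_of_hallPlusUp D hp hpos
    omega
  · have h0 : (D.P.map Prod.snd).sum = 0 := by omega
    rw [h0]
    norm_num

/-! ## §4 THE PLATE -/

/-- **THE SHELL-3 P-MASS FLOOR (budget-free, Hall-free).**  On the height-`h` alphabet, a design with clause (A1), RULE D, `Disj`, ring `≤ 3`,
`μ ≠ 0` and the three displayed binders (B) `HubfreePB`, (Bu) `NoOffHubfreeP`, (M2) `NHubbed h` has at least `51` P copies. -/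
theorem pmass_ge_51_of_binders {h : ℤ} {D : Design} (hB : HubfreePB D) (hBu : NoOffHubfreeP D) (hM2 : NHubbed h D)
    (hD : D.OnAlphabet h) (hdis : Disj D) (h1 : D.A1) (hr : RuleD D) (hμ : D.mu ≠ 0) (hR : RingLe 3 D) :
    51 ≤ (((D.P.map Prod.snd).sum : ℕ) : ℤ) := by
  have h3 : Ring3 D := fun x hx f => hR x hx f
  have hA : A1e D := a1e_of_a1 D h1
  have hAx : HubfreePAxis h D := hubfreePAxis_of_noOff hD hBu
  have h24 := pmass_ge_24 h D hD hA hμ hM2 hAx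
  have h16 := sixteen_pmass_le h D hD hA hμ hM2 hAx
  have h9 := nine_negE_add_hubfreeMass_le hD h1 hr hdis h3 hB hBu
  rw [hubfreeMass_eq hD, negE_eq_pmass h D hM2] at h9
  exact fiftyone_le h24 h9 h16

/-- **THE PLATE `shell3_empty_of_binders`.**  Height-`h` alphabet, clause (A1), RULE D, `Disj`, PortHall₈, `μ ≠ 0`, the budget clause of any
`σ ≥ 28·copies`, ring `≤ 3`, and the three displayed binders (B), (Bu), (M2) ⟹ `False` (`51 ≤ Σ_P m ≤ 50`). -/
theorem shell3_empty_of_binders {h : ℤ} (σ : Design → ℤ) {D : Design} (hσ : 28 * (D.copies : ℤ) ≤ σ D)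
    (hB : HubfreePB D) (hBu : NoOffHubfreeP D) (hM2 : NHubbed h D)
    (hD : D.OnAlphabet h) (hdis : Disj D) (h1 : D.A1) (hr : RuleD D) (hp : HallPlusUp D 8) (hμ : D.mu ≠ 0)
    (hb : BudgetClause σ 0 D) (hR : RingLe 3 D) : False := by
  have h51 := pmass_ge_51_of_binders hB hBu hM2 hD hdis h1 hr hμ hR
  have h50 := pmass_le_fifty σ hσ hb hp
  omega

/-- the plate with (M2) in the co-level currency `NoHubfreeN`. -/
theorem shell3_empty_of_binders_col {h : ℤ} (σ : Design → ℤ) {D : Design} (hσ : 28 * (D.copies : ℤ) ≤ σ D)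
    (hB : HubfreePB D) (hBu : NoOffHubfreeP D) (hM2 : NoHubfreeN D)
    (hD : D.OnAlphabet h) (hdis : Disj D) (h1 : D.A1) (hr : RuleD D) (hp : HallPlusUp D 8) (hμ : D.mu ≠ 0)
    (hb : BudgetClause σ 0 D) (hR : RingLe 3 D) : False :=
  shell3_empty_of_binders σ hσ hB hBu (nHubbed_of_noHubfreeN hD hM2) hD hdis h1 hr hp hμ hb hR

/-- the plate in the currency of record `σ_H` (`SigmaH.diag_le_sigmaH : 28·copies ≤ σ_H`). -/
theorem shell3_empty_of_binders_sigmaH {h : ℤ} {D : Design}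
    (hB : HubfreePB D) (hBu : NoOffHubfreeP D) (hM2 : NHubbed h D)
    (hD : D.OnAlphabet h) (hdis : Disj D) (h1 : D.A1) (hr : RuleD D) (hp : HallPlusUp D 8) (hμ : D.mu ≠ 0)
    (hb : BudgetClause sigmaH 0 D) (hR : RingLe 3 D) : False :=
  shell3_empty_of_binders sigmaH (diag_le_sigmaH D) hB hBu hM2 hD hdis h1 hr hp hμ hb hR

/-- the three displayed binders as one predicate. -/
def Binders (h : ℤ) (D : Design) : Prop := HubfreePB D ∧ NoOffHubfreeP D ∧ NHubbed h D

/-- **the plate in the exact binder order of `DeepLayerLaws.RingRoomB h (BudgetClause σ 0) 3`, binders prefixed** (director R19.724 (2) target;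
`HallUp` is carried and not used). -/
theorem shell3_empty_roomShape (h : ℤ) (σ : Design → ℤ) (hσ : ∀ D : Design, 28 * (D.copies : ℤ) ≤ σ D) :
    ∀ D : Design, HubfreePB D → NoOffHubfreeP D → NHubbed h D →
      D.OnAlphabet h → Disj D → D.A1 → RuleD D → HallUp D → HallPlusUp D 8 → D.mu ≠ 0 →
        BudgetClause σ 0 D → RingLe 3 D → False :=
  fun D hB hBu hM2 hD hdis h1 hr _ hp hμ hb hR => shell3_empty_of_binders σ (hσ D) hB hBu hM2 hD hdis h1 hr hp hμ hb hR

/-! ## §5 CONDITIONAL CLOSURES: room 3, shell 3, the height-3 item, and the residual ledger from shell 4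
(the shell-1 ∕ shell-2 closures and the shift dictionary are the one-liners of `ShellLedger` §1∕§2∕§5, restated here over their built sources
`RingTwoEffEmpty.ring1_mu_eq_zero_allHeights`, `RingTwoMassLaw.ClassLaw.sPlus_ring2`, `DeepLayerLaws.ringRoomB_iff_sPlusB`) -/

/-- if the three binders hold on EVERY design of room 3 (this is what the support-enumeration certificates of record assert), ROOM 3 is closed
for the budget clause of any `σ ≥ 28·copies`. -/
theorem ringRoom_three_closed_of_binders (h : ℤ) (σ : Design → ℤ) (hσ : ∀ D : Design, 28 * (D.copies : ℤ) ≤ σ D)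
    (H : ∀ D : Design, D.OnAlphabet h → Disj D → D.A1 → RuleD D → HallUp D → HallPlusUp D 8 → D.mu ≠ 0 →
      BudgetClause σ 0 D → RingLe 3 D → Binders h D) :
    RingRoomB h (BudgetClause σ 0) 3 := by
  intro D hD hdis h1 hr hu hp hμ hb hR
  obtain ⟨hB, hBu, hM2⟩ := H D hD hdis h1 hr hu hp hμ hb hR
  exact shell3_empty_of_binders σ (hσ D) hB hBu hM2 hD hdis h1 hr hp hμ hb hR

/-- SHELL 3 likewise. -/
theorem shell_three_closed_of_binders (h : ℤ) (σ : Design → ℤ) (hσ : ∀ D : Design, 28 * (D.copies : ℤ) ≤ σ D)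
    (H : ∀ D : Design, D.OnAlphabet h → Disj D → D.A1 → RuleD D → HallUp D → HallPlusUp D 8 → D.mu ≠ 0 →
      BudgetClause σ 0 D → RingLe 3 D → Binders h D) :
    RingShellB h (BudgetClause σ 0) 3 :=
  ringShellB_of_ringRoomB (ringRoom_three_closed_of_binders h σ hσ H)

/-- room 3 in the currency of record `σ_H`. -/
theorem ringRoom_three_closed_sigmaH_of_binders (h : ℤ)
    (H : ∀ D : Design, D.OnAlphabet h → Disj D → D.A1 → RuleD D → HallUp D → HallPlusUp D 8 → D.mu ≠ 0 →
      BudgetClause sigmaH 0 D → RingLe 3 D → Binders h D) :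
    RingRoomB h (BudgetClause sigmaH 0) 3 :=
  ringRoom_three_closed_of_binders h sigmaH diag_le_sigmaH H

/-- SHELL 3 in the currency of record. -/
theorem shell_three_closed_sigmaH_of_binders (h : ℤ)
    (H : ∀ D : Design, D.OnAlphabet h → Disj D → D.A1 → RuleD D → HallUp D → HallPlusUp D 8 → D.mu ≠ 0 →
      BudgetClause sigmaH 0 D → RingLe 3 D → Binders h D) :
    RingShellB h (BudgetClause sigmaH 0) 3 :=
  ringShellB_of_ringRoomB (ringRoom_three_closed_sigmaH_of_binders h H)

/-- SHELL 1 is closed at every height for every budget (`μ = 0` on ring 1; verbatim `ShellLedger.shell_one_closed`). -/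
theorem shell_one_closed (h : ℤ) (Budget : Design → Prop) : RingShellB h Budget 1 :=
  ringShellB_of_ringRoomB fun _D hA hd _ hr _ _ hμ _ hR => hμ (ring1_mu_eq_zero_allHeights hA hR hd hr)

/-- SHELL 2 is closed for the budget clause of any `σ ≥ 28·copies` (dual g15 cube covering; verbatim `ShellLedger.shell_two_closed_sigma`). -/
theorem shell_two_closed_sigma (h : ℤ) (σ : Design → ℤ) (hσ : ∀ D : Design, 28 * (D.copies : ℤ) ≤ σ D) :
    RingShellB h (BudgetClause σ 0) 2 :=
  ringShellB_of_ringRoomB fun D hA hd h1 hr _ hp hμ hb hR => sPlus_ring2 σ (hσ D) hA hR hd h1 hr hp hμ hb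

/-- room `c` at height `h ≥ c` ⟺ the height-`c` item, for a shift-invariant `σ` (verbatim the `ShellLedger` §5 dictionary). -/
theorem ringRoom_iff_sPlus {h c : ℤ} (hc : c ≤ h) (σ : Design → ℤ) (hshift : ∀ (t : ℤ) (D : Design), σ (shiftD t D) = σ D) :
    RingRoomB h (BudgetClause σ 0) c ↔ SPlus c σ 0 := by
  unfold SPlus
  exact ringRoomB_iff_sPlusB hc (budgetClause_shiftD σ 0 hshift)

/-- THE HEIGHT-3 ITEM `SPlus 3 σ_H 0`, conditional on the binders over room 3 at height 14. -/
theorem sPlus_three_sigmaH_of_binders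
    (H : ∀ D : Design, D.OnAlphabet 14 → Disj D → D.A1 → RuleD D → HallUp D → HallPlusUp D 8 → D.mu ≠ 0 →
      BudgetClause sigmaH 0 D → RingLe 3 D → Binders 14 D) :
    SPlus 3 sigmaH 0 :=
  (ringRoom_iff_sPlus (by norm_num) sigmaH sigmaH_shiftD).mp (ringRoom_three_closed_sigmaH_of_binders 14 H)

/-- the same item from the binders over room 3 AT HEIGHT 3 directly (no shift): `RingRoomB 3 B 3 ↔ SPlusB 3 B`. -/
theorem sPlus_three_of_binders_height_three (σ : Design → ℤ) (hσ : ∀ D : Design, 28 * (D.copies : ℤ) ≤ σ D)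
    (H : ∀ D : Design, D.OnAlphabet 3 → Disj D → D.A1 → RuleD D → HallUp D → HallPlusUp D 8 → D.mu ≠ 0 →
      BudgetClause σ 0 D → RingLe 3 D → Binders 3 D) :
    SPlus 3 σ 0 := by
  unfold SPlus
  intro D hD hdis h1 hr hu hp hμ hb
  have hR : RingLe 3 D := fun x hx f => DepthBoundA4.colevel_le_of_onAlphabet (hD x hx f)
  exact ringRoom_three_closed_of_binders 3 σ hσ H D hD hdis h1 hr hu hp hμ hb hR

/-- **THE RESIDUAL LEDGER FROM SHELL 4:** given the binders over room 3 at height 14, `SPlus 14 σ_H 0 ⟺` shells `4 … 14` of it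
(shells 1, 2 kernel-closed; shell 3 closed by the plate). -/
theorem sPlus_fourteen_sigmaH_iff_shells_from_four_of_binders
    (H : ∀ D : Design, D.OnAlphabet 14 → Disj D → D.A1 → RuleD D → HallUp D → HallPlusUp D 8 → D.mu ≠ 0 →
      BudgetClause sigmaH 0 D → RingLe 3 D → Binders 14 D) :
    SPlus 14 sigmaH 0 ↔ ∀ c : ℤ, 4 ≤ c → c ≤ 14 → RingShellB 14 (BudgetClause sigmaH 0) c := by
  unfold SPlus
  constructor
  · intro HS c _ _
    exact shells_of_sPlusB HS c
  · intro HS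
    refine sPlusB_of_shells (by norm_num) _ fun c hc1 hc14 => ?_
    rcases (show c = 1 ∨ c = 2 ∨ c = 3 ∨ 4 ≤ c by omega) with rfl | rfl | rfl | h4
    · exact shell_one_closed 14 _
    · exact shell_two_closed_sigma 14 sigmaH diag_le_sigmaH
    · exact shell_three_closed_sigmaH_of_binders 14 H
    · exact HS c h4 hc14

end Summit.HodgeConjecture.HodgeConjecture.Cruxes.BlochSeedDiscOne.ShellThreeClosed
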